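import Literature.AlgebraicGeometry.Modules.WedgeTransition
import Literature.AlgebraicGeometry.Modules.LineBundleOfCocycleClass
import HarnessLib

/-!
# Glueing rank-one modules along an open cover from a descent datum on wedges

Layer `Literature/AlgebraicGeometry/Modules`, namespace `Literature.AlgebraicGeometry.Modules`.
THEOREMS ONLY (no definition, no named fact, no instance).

[StacksProject, Tag 04TP (glueing sheaves of modules) / Tag 00AK (glueing sheaves)]; Hartshorne II Ex. 1.22
and III Ex. 4.5.  For an open cover `𝒰 = (fᵢ : Xᵢ → X)` of a scheme `X`, rank-one `𝒪_{Xᵢ}`-modules `Lᵢ` and a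
DESCENT DATUM ON WEDGES — isomorphisms `φ a b : a^*Lᵢ ≅ b^*Lⱼ` for all schemes `T` and all `a : T → Xᵢ`,
`b : T → Xⱼ` with `a ≫ fᵢ = b ≫ fⱼ`, natural under pull-back (`hnat`, through Mathlib's
`Scheme.Modules.pullbackComp`) and satisfying the cocycle identity on triple wedges (`hcoc`) — the main theorem
`exists_hasRank_one_forall_nonempty_pullback_iso_of_wedge_cocycle` produces a rank-one `𝒪_X`-module `M` with
`fᵢ^*M ≅ Lᵢ` for every `i` (WEAK output: no compatibility of the chart isomorphisms with `φ` is asserted).  This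
is the (Z1) letter `stub_F3Z1` of the F-3 dual-pair line (typed by B-typ04; consumer: the Zariski glueing of dual
pairs of abelian schemes), proved on the Čech-cocycle road over the tree's `Modules/` capital:

* wedge values (`topIso_wedge_mul`, `topIso_wedge_self`, `topIso_wedge_ι`, `map_topIso_wedge`,
  `appLE_topIso_wedge`) — the wedge transition functions of `Modules/WedgeTransition.lean` over an open `V`,
  read in `Γ(Z, V)` through Mathlib's `Scheme.Opens.topIso`; they are multiplicative (`hcoc`), equal to `1` on
  the diagonal, equal to frame transition functions on the diagonal of one chart, and compatible with
  restriction and with pull-back along morphisms (`hnat`);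
* the main theorem: the point-indexed ★ `UnitCocycle` on `X` of wedge values, its ★ `lineBundle`, and for
  every chart the COBOUNDARY between the pulled-back cocycle and the determinant cocycle of a frame system of
  `Lᵢ`, whence `fᵢ^*M ≅ Lᵢ` by ★ `detClass_pullback`, ★ `detClass_lineBundle`, ★ `nonempty_iso_iff_detClass_eq`.

Everything is proved; no named facts.

## References

* The Stacks Project, Tag 04TP (glueing sheaves of modules), Tag 00AK (glueing sheaves). [StacksProject]
* R. Hartshorne, *Algebraic Geometry*, GTM 52 (1977), II Ex. 1.22, II Ex. 5.16, III Ex. 4.5. [Hartshorne1977]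
-/

noncomputable section

-- `TopCat.Presheaf`/`Scheme.Modules` are not reducible (as in Mathlib's `AlgebraicGeometry/Modules/Sheaf.lean`).
set_option backward.isDefEq.respectTransparency false

open CategoryTheory AlgebraicGeometry Opposite TopologicalSpace

universe u

namespace Literature.AlgebraicGeometry.Modules

open Literature.AlgebraicGeometry.Motives

/-! ### Wedge values over opens: the transition functions of the glued cocycle

For an open cover `𝒰` of `X`, modules `L i` on the charts and a descent datum `φ` on wedges, the *wedge
value* over an open `V` of a scheme `Z` of two wedge maps `a : V ⟶ 𝒰.X j₁`, `b : V ⟶ 𝒰.X j₂` (defined on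
the open subscheme `V`, with `a ≫ 𝒰.f j₁ = b ≫ 𝒰.f j₂`) and two frames `e₁`, `e₂` of `L j₁`, `L j₂` whose
opens pull back to all of `V` is the wedge transition function over `⊤ : V.Opens`, read in `Γ(Z, V)`
through Mathlib's `Scheme.Opens.topIso : Γ(V, ⊤) ≅ Γ(Z, V)`. -/

section WedgeValues

universe v

variable {X : Scheme.{u}} (𝒰 : Scheme.OpenCover.{v} X) (L : ∀ i, (𝒰.X i).Modules)
  (φ : ∀ ⦃i j : 𝒰.I₀⦄ ⦃T : Scheme.{u}⦄ (a : T ⟶ 𝒰.X i) (b : T ⟶ 𝒰.X j), a ≫ 𝒰.f i = b ≫ 𝒰.f j →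
    ((Scheme.Modules.pullback a).obj (L i) ≅ (Scheme.Modules.pullback b).obj (L j)))
  (hnat : ∀ ⦃i j : 𝒰.I₀⦄ ⦃T T' : Scheme.{u}⦄ (t : T' ⟶ T) (a : T ⟶ 𝒰.X i) (b : T ⟶ 𝒰.X j)
    (h : a ≫ 𝒰.f i = b ≫ 𝒰.f j),
    (Scheme.Modules.pullback t).mapIso (φ a b h) =
      (Scheme.Modules.pullbackComp t a).app (L i) ≪≫
        φ (t ≫ a) (t ≫ b) (by rw [Category.assoc, h, Category.assoc]) ≪≫
          ((Scheme.Modules.pullbackComp t b).app (L j)).symm)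
  (hcoc : ∀ ⦃i j k : 𝒰.I₀⦄ ⦃T : Scheme.{u}⦄ (a : T ⟶ 𝒰.X i) (b : T ⟶ 𝒰.X j) (c : T ⟶ 𝒰.X k)
    (hab : a ≫ 𝒰.f i = b ≫ 𝒰.f j) (hbc : b ≫ 𝒰.f j = c ≫ 𝒰.f k),
    φ a b hab ≪≫ φ b c hbc = φ a c (hab.trans hbc))

/-! ### Bookkeeping: `topIso`, restrictions, lifts into charts -/

/-- An isomorphism `φ` with `φ ≪≫ φ = φ` is the identity (used on the diagonal of a cocycle of
isomorphisms: `φ_{aa} ≪≫ φ_{aa} = φ_{aa}`). [folklore] -/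
private theorem Iso.eq_refl_of_trans_self {C : Type*} [Category C] {A : C} (φ : A ≅ A) (h : φ ≪≫ φ = φ) :
    φ = Iso.refl A := by
  ext
  have h' : φ.hom ≫ φ.hom = φ.hom ≫ 𝟙 A := by
    rw [Category.comp_id]
    exact congrArg Iso.hom h
  exact (cancel_epi φ.hom).1 h'

/-- `topIso` followed by restriction to a smaller open is `(Z.homOfLE i)^♯` followed by `topIso`
(as morphisms `Γ(V, ⊤) ⟶ Γ(Z, V')`). [folklore] -/
private theorem topIso_hom_comp_map {Z : Scheme.{u}} {V V' : Z.Opens} (i : V' ≤ V) :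
    V.topIso.hom ≫ Z.presheaf.map (homOfLE i).op = (Z.homOfLE i).appLE ⊤ ⊤ le_top ≫ V'.topIso.hom := by
  rw [Scheme.homOfLE_appLE, Scheme.Opens.topIso_hom, Scheme.Opens.topIso_hom, ← Functor.map_comp,
    ← Functor.map_comp]
  rfl

/-- `topIso` followed by `g^♯ : Γ(Z, V) → Γ(Z', W)` is `(g|_W)^♯ : Γ(V, ⊤) → Γ(W, ⊤)` followed by `topIso`
(Mathlib `Scheme.Hom.resLE_appLE`). [folklore] -/
private theorem topIso_hom_comp_appLE {Z Z' : Scheme.{u}} (g : Z' ⟶ Z) {V : Z.Opens} {W : Z'.Opens} (hW : W ≤ g ⁻¹ᵁ V) :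
    V.topIso.hom ≫ g.appLE V W hW = (g.resLE V W hW).appLE ⊤ ⊤ le_top ≫ W.topIso.hom := by
  rw [Scheme.Hom.resLE_appLE, Scheme.Opens.topIso_hom, Scheme.Opens.topIso_hom, Scheme.Hom.map_appLE,
    Scheme.Hom.appLE_map]

/-- `V.ι^♯ : Γ(Y, U) → Γ(V, ⊤)` followed by `topIso` is the restriction `Γ(Y, U) → Γ(Y, V)` (`V ≤ U`).
[folklore] -/
private theorem ι_appLE_comp_topIso_hom {Y : Scheme.{u}} (V U : Y.Opens) (l : (⊤ : (V : Scheme.{u}).Opens) ≤ V.ι ⁻¹ᵁ U)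
    (h : V ≤ U) : V.ι.appLE U ⊤ l ≫ V.topIso.hom = Y.presheaf.map (homOfLE h).op := by
  rw [Scheme.Opens.ι_appLE, Scheme.Opens.topIso_hom, ← Functor.map_comp]
  rfl

/-- If a wedge map `a` over `g : T ⟶ X` (`a ≫ f = g`, `f` an open immersion) is such that `g` maps an
open `O` into the image `f(W)`, then `O ≤ a⁻¹W` (injectivity of `f`). [folklore] -/
private theorem le_preimage_of_comp_eq_of_mem_image {T Y : Scheme.{u}} (a : T ⟶ Y) (f : Y ⟶ X) [IsOpenImmersion f]
    (g : T ⟶ X) (hag : a ≫ f = g) (W : Y.Opens) (O : T.Opens) (h : ∀ t : T, t ∈ O → g t ∈ f ''ᵁ W) :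
    O ≤ a ⁻¹ᵁ W := by
  intro t ht
  obtain ⟨w, hw, hfw⟩ := h t ht
  have hft : f (a t) = g t := by rw [← hag]; exact (Scheme.Hom.comp_apply a f t).symm
  have hwa : w = a t := f.isOpenEmbedding.injective (hfw.trans hft.symm)
  show a t ∈ W
  rw [← hwa]
  exact hw

include hcoc in
/-- **Multiplicativity of wedge values** (`hcoc`): for three wedge maps `a`, `b`, `c` on the open subscheme
`V` and frames `e₁`, `e₂`, `e₃`, the wedge values satisfy `u(a,b) · u(b,c) = u(a,c)` in `Γ(Z, V)`.
[cite: StacksProject, Tag 04TP (glueing sheaves of modules: the cocycle condition)] -/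
theorem topIso_wedge_mul {Z : Scheme.{u}} (V : Z.Opens) {j₁ j₂ j₃ : 𝒰.I₀} (a : (V : Scheme.{u}) ⟶ 𝒰.X j₁)
    (b : (V : Scheme.{u}) ⟶ 𝒰.X j₂) (c : (V : Scheme.{u}) ⟶ 𝒰.X j₃) (hab : a ≫ 𝒰.f j₁ = b ≫ 𝒰.f j₂)
    (hbc : b ≫ 𝒰.f j₂ = c ≫ 𝒰.f j₃) (hac : a ≫ 𝒰.f j₁ = c ≫ 𝒰.f j₃) {U₁ : (𝒰.X j₁).Opens}
    {U₂ : (𝒰.X j₂).Opens} {U₃ : (𝒰.X j₃).Opens} {I₁ I₂ I₃ : Type u} [Fintype I₁] [Fintype I₂] [Fintype I₃]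
    (e₁ : SheafOfModules.free I₁ ≅ (L j₁).over U₁) (e₂ : SheafOfModules.free I₂ ≅ (L j₂).over U₂)
    (e₃ : SheafOfModules.free I₃ ≅ (L j₃).over U₃) {n₁ n₂ n₃ : ℕ} (ε₁ : I₁ ≃ Fin n₁) (ε₂ : I₂ ≃ Fin n₂)
    (ε₃ : I₃ ≃ Fin n₃) (k₁ : (⊤ : (V : Scheme.{u}).Opens) ≤ a ⁻¹ᵁ U₁) (k₂ : (⊤ : (V : Scheme.{u}).Opens) ≤ b ⁻¹ᵁ U₂)
    (k₃ : (⊤ : (V : Scheme.{u}).Opens) ≤ c ⁻¹ᵁ U₃) :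
    V.topIso.hom
        (transitionDet (pullbackFrame a e₁ ≪≫ (SheafOfModules.overFunctor _ (a ⁻¹ᵁ U₁)).mapIso (φ a b hab))
          (pullbackFrame b e₂) ε₁ ε₂ (homOfLE k₁) (homOfLE k₂)) *
      V.topIso.hom
        (transitionDet (pullbackFrame b e₂ ≪≫ (SheafOfModules.overFunctor _ (b ⁻¹ᵁ U₂)).mapIso (φ b c hbc))
          (pullbackFrame c e₃) ε₂ ε₃ (homOfLE k₂) (homOfLE k₃)) =
      V.topIso.hom
        (transitionDet (pullbackFrame a e₁ ≪≫ (SheafOfModules.overFunctor _ (a ⁻¹ᵁ U₁)).mapIso (φ a c hac))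
          (pullbackFrame c e₃) ε₁ ε₃ (homOfLE k₁) (homOfLE k₃)) := by
  rw [← map_mul]
  exact congrArg _ (transitionDet_wedge_mul a b c e₁ e₂ e₃ ε₁ ε₂ ε₃ _ _ _ (hcoc a b c hab hbc) _ _ _)

include hcoc in
/-- **Wedge values on the diagonal are `1`**: for a single wedge map `a` and a single frame `e`, the
wedge value `u(a,a)` is `1` (`φ_{aa} ≪≫ φ_{aa} = φ_{aa}` forces `φ_{aa} = 1`, and `det T(e, e) = 1`).
[cite: StacksProject, Tag 04TP (glueing sheaves of modules)] -/
theorem topIso_wedge_self {Z : Scheme.{u}} (V : Z.Opens) {j : 𝒰.I₀} (a : (V : Scheme.{u}) ⟶ 𝒰.X j)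
    (h : a ≫ 𝒰.f j = a ≫ 𝒰.f j) {U : (𝒰.X j).Opens} {I : Type u} [Fintype I]
    (e : SheafOfModules.free I ≅ (L j).over U) {n : ℕ} (ε : I ≃ Fin n)
    (k : (⊤ : (V : Scheme.{u}).Opens) ≤ a ⁻¹ᵁ U) :
    V.topIso.hom
        (transitionDet (pullbackFrame a e ≪≫ (SheafOfModules.overFunctor _ (a ⁻¹ᵁ U)).mapIso (φ a a h))
          (pullbackFrame a e) ε ε (homOfLE k) (homOfLE k)) = 1 := by
  have hφ : φ a a h = Iso.refl _ := Iso.eq_refl_of_trans_self _ (hcoc a a a h h)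
  have l : (⊤ : (V : Scheme.{u}).Opens) ≤ a ⁻¹ᵁ (U ⊓ U) := fun z hz => ⟨k hz, k hz⟩
  rw [transitionDet_wedge_refl a e ε e ε (φ a a h) hφ l, transitionDet_self, map_one, map_one]

include hcoc in
/-- **Wedge values on the diagonal of ONE chart are frame transition functions**: on an open `V` of the
chart `𝒰.X j` itself, with both wedge maps the inclusion `V.ι`, the wedge value of two frames `e`, `e'` of
`L j` is `det T(e, e')|_V` (★ `transitionDet_pullbackFrame` along `V.ι`, Mathlib `Scheme.Opens.ι_appLE`).
[cite: Hartshorne1977, II Ex. 5.16] -/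
theorem topIso_wedge_ι {j : 𝒰.I₀} (V : (𝒰.X j).Opens) (h : V.ι ≫ 𝒰.f j = V.ι ≫ 𝒰.f j)
    {U U' : (𝒰.X j).Opens} {I I' : Type u} [Fintype I] [Fintype I']
    (e : SheafOfModules.free I ≅ (L j).over U) (e' : SheafOfModules.free I' ≅ (L j).over U') {n n' : ℕ}
    (ε : I ≃ Fin n) (ε' : I' ≃ Fin n') (hV : V ≤ U) (hV' : V ≤ U')
    (k : (⊤ : (V : Scheme.{u}).Opens) ≤ V.ι ⁻¹ᵁ U) (k' : (⊤ : (V : Scheme.{u}).Opens) ≤ V.ι ⁻¹ᵁ U') :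
    V.topIso.hom
        (transitionDet (pullbackFrame V.ι e ≪≫ (SheafOfModules.overFunctor _ (V.ι ⁻¹ᵁ U)).mapIso (φ V.ι V.ι h))
          (pullbackFrame V.ι e') ε ε' (homOfLE k) (homOfLE k')) =
      transitionDet e e' ε ε' (homOfLE hV) (homOfLE hV') := by
  have hφ : φ V.ι V.ι h = Iso.refl _ := Iso.eq_refl_of_trans_self _ (hcoc V.ι V.ι V.ι h h)
  have l : (⊤ : (V : Scheme.{u}).Opens) ≤ V.ι ⁻¹ᵁ (U ⊓ U') := fun z hz => ⟨k hz, k' hz⟩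
  rw [transitionDet_wedge_refl V.ι e ε e' ε' (φ V.ι V.ι h) hφ l]
  change (V.ι.appLE (U ⊓ U') ⊤ l ≫ V.topIso.hom) _ = _
  rw [ι_appLE_comp_topIso_hom V (U ⊓ U') l (le_inf hV hV'), transitionDet_map]
  exact transitionDet_congr_hom _ _ ε ε' _ _ _ _

include hnat in
/-- **Wedge values restrict** (`hnat`): for opens `V' ≤ V` of `Z` and wedge maps `a`, `b` on `V` whose
restrictions to `V'` are `a'`, `b'`, the wedge value over `V` restricts to the wedge value over `V'`
(base change of wedge transition functions along `Z.homOfLE`, Mathlib `Scheme.homOfLE_appLE`).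
[cite: StacksProject, Tag 04TP (glueing sheaves of modules)] -/
theorem map_topIso_wedge {Z : Scheme.{u}} {V V' : Z.Opens} (i : V' ≤ V) {j₁ j₂ : 𝒰.I₀}
    (a : (V : Scheme.{u}) ⟶ 𝒰.X j₁) (b : (V : Scheme.{u}) ⟶ 𝒰.X j₂) (hab : a ≫ 𝒰.f j₁ = b ≫ 𝒰.f j₂)
    (a' : (V' : Scheme.{u}) ⟶ 𝒰.X j₁) (b' : (V' : Scheme.{u}) ⟶ 𝒰.X j₂) (ha' : a' = Z.homOfLE i ≫ a)
    (hb' : b' = Z.homOfLE i ≫ b) (hab' : a' ≫ 𝒰.f j₁ = b' ≫ 𝒰.f j₂) {U₁ : (𝒰.X j₁).Opens}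
    {U₂ : (𝒰.X j₂).Opens} {I₁ I₂ : Type u} [Fintype I₁] [Fintype I₂]
    (e₁ : SheafOfModules.free I₁ ≅ (L j₁).over U₁) (e₂ : SheafOfModules.free I₂ ≅ (L j₂).over U₂) {n₁ n₂ : ℕ}
    (ε₁ : I₁ ≃ Fin n₁) (ε₂ : I₂ ≃ Fin n₂) (k₁ : (⊤ : (V : Scheme.{u}).Opens) ≤ a ⁻¹ᵁ U₁)
    (k₂ : (⊤ : (V : Scheme.{u}).Opens) ≤ b ⁻¹ᵁ U₂) (k₁' : (⊤ : (V' : Scheme.{u}).Opens) ≤ a' ⁻¹ᵁ U₁)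
    (k₂' : (⊤ : (V' : Scheme.{u}).Opens) ≤ b' ⁻¹ᵁ U₂) :
    Z.presheaf.map (homOfLE i).op (V.topIso.hom
        (transitionDet (pullbackFrame a e₁ ≪≫ (SheafOfModules.overFunctor _ (a ⁻¹ᵁ U₁)).mapIso (φ a b hab))
          (pullbackFrame b e₂) ε₁ ε₂ (homOfLE k₁) (homOfLE k₂))) =
      V'.topIso.hom
        (transitionDet (pullbackFrame a' e₁ ≪≫ (SheafOfModules.overFunctor _ (a' ⁻¹ᵁ U₁)).mapIso (φ a' b' hab'))
          (pullbackFrame b' e₂) ε₁ ε₂ (homOfLE k₁') (homOfLE k₂')) := by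
  have k₁'' : (⊤ : (V' : Scheme.{u}).Opens) ≤ (Z.homOfLE i ≫ a) ⁻¹ᵁ U₁ := by rw [← ha']; exact k₁'
  have k₂'' : (⊤ : (V' : Scheme.{u}).Opens) ≤ (Z.homOfLE i ≫ b) ⁻¹ᵁ U₂ := by rw [← hb']; exact k₂'
  have key := transitionDet_wedge_baseChange a b e₁ e₂ ε₁ ε₂ (Z.homOfLE i) (φ a b hab)
    (φ (Z.homOfLE i ≫ a) (Z.homOfLE i ≫ b) (by rw [Category.assoc, hab, Category.assoc]))
    (hnat (Z.homOfLE i) a b hab) (homOfLE k₁) (homOfLE k₂) (O' := ⊤) le_top (homOfLE k₁'') (homOfLE k₂'')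
  have cg := transitionDet_wedge_congr e₁ e₂ ε₁ ε₂ (𝒰.f j₁) (𝒰.f j₂) (fun a b h => φ a b h) ha'.symm hb'.symm
    (by rw [Category.assoc, hab, Category.assoc]) hab' (homOfLE k₁'') (homOfLE k₂'') (homOfLE k₁') (homOfLE k₂')
  rw [← cg, ← key]
  change (V.topIso.hom ≫ Z.presheaf.map (homOfLE i).op) _ = ((Z.homOfLE i).appLE ⊤ ⊤ le_top ≫ V'.topIso.hom) _
  rw [topIso_hom_comp_map]

include hnat in
/-- **Wedge values pull back** (`hnat`): for `g : Z' ⟶ Z`, opens `W ≤ g⁻¹V`, wedge maps `a`, `b` on `V`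
and `a'`, `b'` on `W` with `a' = g|_W ≫ a`, `b' = g|_W ≫ b` (Mathlib `Scheme.Hom.resLE`), `g^♯` of the wedge
value over `V` is the wedge value over `W` (base change of wedge transition functions along `g.resLE V W`,
Mathlib `Scheme.Hom.resLE_appLE`). [cite: StacksProject, Tag 04TP (glueing sheaves of modules)] -/
theorem appLE_topIso_wedge {Z Z' : Scheme.{u}} (g : Z' ⟶ Z) {V : Z.Opens} {W : Z'.Opens} (hW : W ≤ g ⁻¹ᵁ V)
    {j₁ j₂ : 𝒰.I₀} (a : (V : Scheme.{u}) ⟶ 𝒰.X j₁) (b : (V : Scheme.{u}) ⟶ 𝒰.X j₂)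
    (hab : a ≫ 𝒰.f j₁ = b ≫ 𝒰.f j₂) (a' : (W : Scheme.{u}) ⟶ 𝒰.X j₁) (b' : (W : Scheme.{u}) ⟶ 𝒰.X j₂)
    (ha' : a' = g.resLE V W hW ≫ a) (hb' : b' = g.resLE V W hW ≫ b) (hab' : a' ≫ 𝒰.f j₁ = b' ≫ 𝒰.f j₂)
    {U₁ : (𝒰.X j₁).Opens} {U₂ : (𝒰.X j₂).Opens} {I₁ I₂ : Type u} [Fintype I₁] [Fintype I₂]
    (e₁ : SheafOfModules.free I₁ ≅ (L j₁).over U₁) (e₂ : SheafOfModules.free I₂ ≅ (L j₂).over U₂) {n₁ n₂ : ℕ}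
    (ε₁ : I₁ ≃ Fin n₁) (ε₂ : I₂ ≃ Fin n₂) (k₁ : (⊤ : (V : Scheme.{u}).Opens) ≤ a ⁻¹ᵁ U₁)
    (k₂ : (⊤ : (V : Scheme.{u}).Opens) ≤ b ⁻¹ᵁ U₂) (k₁' : (⊤ : (W : Scheme.{u}).Opens) ≤ a' ⁻¹ᵁ U₁)
    (k₂' : (⊤ : (W : Scheme.{u}).Opens) ≤ b' ⁻¹ᵁ U₂) :
    g.appLE V W hW (V.topIso.hom
        (transitionDet (pullbackFrame a e₁ ≪≫ (SheafOfModules.overFunctor _ (a ⁻¹ᵁ U₁)).mapIso (φ a b hab))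
          (pullbackFrame b e₂) ε₁ ε₂ (homOfLE k₁) (homOfLE k₂))) =
      W.topIso.hom
        (transitionDet (pullbackFrame a' e₁ ≪≫ (SheafOfModules.overFunctor _ (a' ⁻¹ᵁ U₁)).mapIso (φ a' b' hab'))
          (pullbackFrame b' e₂) ε₁ ε₂ (homOfLE k₁') (homOfLE k₂')) := by
  have k₁'' : (⊤ : (W : Scheme.{u}).Opens) ≤ (g.resLE V W hW ≫ a) ⁻¹ᵁ U₁ := by rw [← ha']; exact k₁'
  have k₂'' : (⊤ : (W : Scheme.{u}).Opens) ≤ (g.resLE V W hW ≫ b) ⁻¹ᵁ U₂ := by rw [← hb']; exact k₂'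
  have key := transitionDet_wedge_baseChange a b e₁ e₂ ε₁ ε₂ (g.resLE V W hW) (φ a b hab)
    (φ (g.resLE V W hW ≫ a) (g.resLE V W hW ≫ b) (by rw [Category.assoc, hab, Category.assoc]))
    (hnat (g.resLE V W hW) a b hab) (homOfLE k₁) (homOfLE k₂) (O' := ⊤) le_top (homOfLE k₁'') (homOfLE k₂'')
  have cg := transitionDet_wedge_congr e₁ e₂ ε₁ ε₂ (𝒰.f j₁) (𝒰.f j₂) (fun a b h => φ a b h) ha'.symm hb'.symm
    (by rw [Category.assoc, hab, Category.assoc]) hab' (homOfLE k₁'') (homOfLE k₂'') (homOfLE k₁') (homOfLE k₂')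
  rw [← cg, ← key]
  change (V.topIso.hom ≫ g.appLE V W hW) _ = ((g.resLE V W hW).appLE ⊤ ⊤ le_top ≫ W.topIso.hom) _
  rw [topIso_hom_comp_appLE]

end WedgeValues

/-! ### Gluing rank-one modules along an open cover from a descent datum on wedges -/

section Gluing

universe v

/-- **GLUEING OF RANK-ONE MODULES ALONG AN OPEN COVER** [StacksProject, Tag 04TP / Tag 00AK], in
descent-datum-on-wedges form with weak output (the (Z1) letter of the F-3 dual-pair assembly, typed by
B-typ04 `stub_F3Z1`): let `𝒰 = (fᵢ : Xᵢ → X)` be an open cover of a scheme `X`, `Lᵢ` rank-one `𝒪_{Xᵢ}`-modules,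
and `φ` a family of isomorphisms `φ a b : a^*Lᵢ ≅ b^*Lⱼ` for every scheme `T` and every wedge `a : T → Xᵢ`,
`b : T → Xⱼ`, `a ≫ fᵢ = b ≫ fⱼ`, natural under pull-back along any `t : T' → T` (`hnat`, through Mathlib's
`Scheme.Modules.pullbackComp`) and satisfying the cocycle identity `φ a b ≪≫ φ b c = φ a c` on triple wedges
(`hcoc`).  Then there is a rank-one `𝒪_X`-module `M` with `fᵢ^*M ≅ Lᵢ` for all `i`.

PROOF (Čech cocycle road over the tree's `Modules/` capital, no new sheaf-gluing engine).  Choose a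
rank-one frame system of every `Lᵢ` (★ `exists_frameSystem_of_hasRank`) and, for every point `x ∈ X`, a chart
`i(x) = 𝒰.idx x` and a preimage `p(x)`; put `U_x := f_{i(x)}(U_{p(x)})` (image of the trivialising
neighbourhood).  For `V ≤ U_x ⊓ U_y` the inclusion `V ↪ X` lifts to wedge maps `a_x^V : V → X_{i(x)}`,
`a_y^V : V → X_{i(y)}` (Mathlib `IsOpenImmersion.lift`), and `g_{xy}(V) ∈ Γ(X, V)` is the WEDGE VALUE: the
determinant of the transition matrix between the frame `(a_x^V)^* e_{p(x)}` transported along `φ(a_x^V, a_y^V)`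
and the frame `(a_y^V)^* e_{p(y)}`.  `hcoc` gives `g_{xy} g_{yz} = g_{xz}` and `g_{xx} = 1`, `hnat` the
compatibility with restriction; `M := lineBundle c` (★ `Modules/LineBundleOfCocycle`, `hasRank_lineBundle`).
For a chart `fᵢ`, the pulled-back cocycle `fᵢ^*c` is COHOMOLOGOUS to the determinant cocycle of the frame
system of `Lᵢ`: the coboundary at `y ∈ Xᵢ` over `W` is the wedge value of `(W.ι, lift of W.ι ≫ fᵢ to
X_{i(fᵢ y)})` between the frame of `Lᵢ` at `y` and `e_{p(fᵢ y)}`, and the coboundary relation is twice the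
multiplicativity of wedge values; hence `[det fᵢ^*M] = fᵢ^*[c] = [det Lᵢ]` in `Ȟ¹(Xᵢ, 𝒪^×)` (★ `detClass_pullback`,
★ `detClass_lineBundle`) and `fᵢ^*M ≅ Lᵢ` by ★ `nonempty_iso_iff_detClass_eq`.  WEAK OUTPUT: no compatibility
of the chart isomorphisms with `φ` is asserted (sufficient for the dual-pair assembly (Z3), whose global
rigidity is restored by re-rigidification).
[cite: StacksProject, Tag 04TP (glueing sheaves of modules) and Tag 00AK (glueing sheaves)]
[cite: Hartshorne1977, II Ex. 1.22 and III Ex. 4.5 (glueing sheaves; `Pic X ≅ Ȟ¹(X, 𝒪_X^×)`)] -/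
theorem exists_hasRank_one_forall_nonempty_pullback_iso_of_wedge_cocycle :
    ∀ {X : Scheme.{u}} (𝒰 : Scheme.OpenCover.{v} X) (L : ∀ i, (𝒰.X i).Modules) (_hL : ∀ i, HasRank (L i) 1)
    (φ : ∀ ⦃i j : 𝒰.I₀⦄ ⦃T : Scheme.{u}⦄ (a : T ⟶ 𝒰.X i) (b : T ⟶ 𝒰.X j), a ≫ 𝒰.f i = b ≫ 𝒰.f j →
      ((Scheme.Modules.pullback a).obj (L i) ≅ (Scheme.Modules.pullback b).obj (L j)))
    (_hnat : ∀ ⦃i j : 𝒰.I₀⦄ ⦃T T' : Scheme.{u}⦄ (t : T' ⟶ T) (a : T ⟶ 𝒰.X i) (b : T ⟶ 𝒰.X j)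
      (h : a ≫ 𝒰.f i = b ≫ 𝒰.f j),
      (Scheme.Modules.pullback t).mapIso (φ a b h) =
        (Scheme.Modules.pullbackComp t a).app (L i) ≪≫
          φ (t ≫ a) (t ≫ b) (by rw [Category.assoc, h, Category.assoc]) ≪≫
            ((Scheme.Modules.pullbackComp t b).app (L j)).symm)
    (_hcoc : ∀ ⦃i j k : 𝒰.I₀⦄ ⦃T : Scheme.{u}⦄ (a : T ⟶ 𝒰.X i) (b : T ⟶ 𝒰.X j) (c : T ⟶ 𝒰.X k)
      (hab : a ≫ 𝒰.f i = b ≫ 𝒰.f j) (hbc : b ≫ 𝒰.f j = c ≫ 𝒰.f k),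
      φ a b hab ≪≫ φ b c hbc = φ a c (hab.trans hbc)),
    ∃ M : X.Modules, HasRank M 1 ∧ ∀ i, Nonempty ((Scheme.Modules.pullback (𝒰.f i)).obj M ≅ L i) := by
  intro X 𝒰 L hL φ hnat hcoc
  classical
  choose F hF using fun i => exists_frameSystem_of_hasRank (hL i)
  have hcov : ∀ x : X, ∃ y : 𝒰.X (𝒰.idx x), 𝒰.f (𝒰.idx x) y = x := fun x => 𝒰.covers x
  choose p hp using hcov
  haveI hfin : ∀ i (y : 𝒰.X i), Fintype ((F i).I y) := fun i y => Fintype.ofEquiv _ ((F i).enum y).symm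
  -- the opens `U_x := f_{i(x)}(U_{p(x)})` of `X`
  obtain ⟨Ux, hUx⟩ : ∃ Ux : X → X.Opens, ∀ x, Ux x = (𝒰.f (𝒰.idx x)) ''ᵁ ((F (𝒰.idx x)).U (p x)) :=
    ⟨_, fun x => rfl⟩
  have mem : ∀ x : X, x ∈ Ux x := fun x => by
    rw [hUx]
    exact ⟨p x, (F (𝒰.idx x)).mem (p x), hp x⟩
  have hrange : ∀ (x : X) (V : X.Opens), V ≤ Ux x → Set.range (V.ι) ⊆ Set.range (𝒰.f (𝒰.idx x)) := by
    intro x V hV z hz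
    rw [Scheme.Opens.range_ι] at hz
    have hz' := hV hz
    rw [hUx] at hz'
    obtain ⟨w, -, hw⟩ := hz'
    exact ⟨w, hw⟩
  -- the wedge maps `a_x^V : V → X_{i(x)}` lifting `V ↪ X`
  obtain ⟨a, ha⟩ : ∃ a : ∀ (x : X) (V : X.Opens), V ≤ Ux x → ((V : Scheme.{u}) ⟶ 𝒰.X (𝒰.idx x)),
      ∀ (x : X) (V : X.Opens) (hV : V ≤ Ux x), a x V hV ≫ 𝒰.f (𝒰.idx x) = V.ι :=
    ⟨fun x V hV => IsOpenImmersion.lift (𝒰.f (𝒰.idx x)) V.ι (hrange x V hV),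
      fun x V hV => IsOpenImmersion.lift_fac _ _ _⟩
  have htop : ∀ (x : X) (V : X.Opens) (hV : V ≤ Ux x),
      (⊤ : (V : Scheme.{u}).Opens) ≤ (a x V hV) ⁻¹ᵁ (F (𝒰.idx x)).U (p x) := by
    intro x V hV
    refine le_preimage_of_comp_eq_of_mem_image (a x V hV) (𝒰.f (𝒰.idx x)) V.ι (ha x V hV) _ ⊤ fun z _ => ?_
    rw [← hUx]
    exact hV z.2
  have hwedge : ∀ (x y : X) (V : X.Opens) (hx : V ≤ Ux x) (hy : V ≤ Ux y),
      a x V hx ≫ 𝒰.f (𝒰.idx x) = a y V hy ≫ 𝒰.f (𝒰.idx y) :=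
    fun x y V hx hy => (ha x V hx).trans (ha y V hy).symm
  have hres : ∀ (x : X) (V V' : X.Opens) (hx : V ≤ Ux x) (i : V' ≤ V),
      a x V' (i.trans hx) = X.homOfLE i ≫ a x V hx := by
    intro x V V' hx i
    rw [← cancel_mono (𝒰.f (𝒰.idx x)), Category.assoc, ha, ha, Scheme.homOfLE_ι]
  -- the glued cocycle
  let c : UnitCocycle X :=
    { U := Ux
      mem := mem
      g := fun x y V hx hy => V.topIso.hom
        (transitionDet (pullbackFrame (a x V hx) ((F (𝒰.idx x)).frame (p x)) ≪≫
            (SheafOfModules.overFunctor _ ((a x V hx) ⁻¹ᵁ (F (𝒰.idx x)).U (p x))).mapIso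
              (φ (a x V hx) (a y V hy) (hwedge x y V hx hy)))
          (pullbackFrame (a y V hy) ((F (𝒰.idx y)).frame (p y))) ((F (𝒰.idx x)).enum (p x))
          ((F (𝒰.idx y)).enum (p y)) (homOfLE (htop x V hx)) (homOfLE (htop y V hy)))
      map_g := fun x y V V' hx hy i =>
        map_topIso_wedge 𝒰 L φ hnat i (a x V hx) (a y V hy) (hwedge x y V hx hy) (a x V' (i.trans hx))
          (a y V' (i.trans hy)) (hres x V V' hx i) (hres y V V' hy i) (hwedge x y V' (i.trans hx) (i.trans hy))
          ((F (𝒰.idx x)).frame (p x)) ((F (𝒰.idx y)).frame (p y)) ((F (𝒰.idx x)).enum (p x))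
          ((F (𝒰.idx y)).enum (p y)) (htop x V hx) (htop y V hy) (htop x V' (i.trans hx))
          (htop y V' (i.trans hy))
      g_mul := fun x y z V hx hy hz =>
        topIso_wedge_mul 𝒰 L φ hcoc V (a x V hx) (a y V hy) (a z V hz) (hwedge x y V hx hy)
          (hwedge y z V hy hz) (hwedge x z V hx hz) ((F (𝒰.idx x)).frame (p x)) ((F (𝒰.idx y)).frame (p y))
          ((F (𝒰.idx z)).frame (p z)) ((F (𝒰.idx x)).enum (p x)) ((F (𝒰.idx y)).enum (p y))
          ((F (𝒰.idx z)).enum (p z)) (htop x V hx) (htop y V hy) (htop z V hz)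
      g_self := fun x V hx =>
        topIso_wedge_self 𝒰 L φ hcoc V (a x V hx) (hwedge x x V hx hx) ((F (𝒰.idx x)).frame (p x))
          ((F (𝒰.idx x)).enum (p x)) (htop x V hx) }
  refine ⟨lineBundle c, c.hasRank_lineBundle, fun i => ?_⟩
  -- `[det f_i^* M] = f_i^*[c] = [det L_i]` in `Ȟ¹(X_i, 𝒪^×)`
  rw [nonempty_iso_iff_detClass_eq (hasRank_pullback (𝒰.f i) c.hasRank_lineBundle) (hL i)
      (c.isFiniteLocallyFree_lineBundle.pullback (𝒰.f i)) (F i).isFiniteLocallyFree,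
    detClass_pullback (𝒰.f i) c.isFiniteLocallyFree_lineBundle, c.detClass_lineBundle, CechPic.pullback_mk,
    detClass_eq_mk _ (F i)]
  -- the coboundary on the chart `f_i : X_i → X`: wedge maps `a₁ y W : W → X_{i(f_i y)}` lifting `W.ι ≫ f_i`
  have hrange₁ : ∀ (y : 𝒰.X i) (W : (𝒰.X i).Opens), W ≤ (𝒰.f i) ⁻¹ᵁ Ux (𝒰.f i y) →
      Set.range (W.ι ≫ 𝒰.f i) ⊆ Set.range (𝒰.f (𝒰.idx (𝒰.f i y))) := by
    intro y W hW z hz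
    obtain ⟨w, rfl⟩ := hz
    have hw := hW w.2
    change 𝒰.f i (W.ι w) ∈ Ux (𝒰.f i y) at hw
    rw [hUx] at hw
    obtain ⟨w', -, hw'⟩ := hw
    exact ⟨w', hw'.trans (Scheme.Hom.comp_apply W.ι (𝒰.f i) w).symm⟩
  obtain ⟨a₁, ha₁⟩ : ∃ a₁ : ∀ (y : 𝒰.X i) (W : (𝒰.X i).Opens), W ≤ (𝒰.f i) ⁻¹ᵁ Ux (𝒰.f i y) →
      ((W : Scheme.{u}) ⟶ 𝒰.X (𝒰.idx (𝒰.f i y))),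
      ∀ (y : 𝒰.X i) (W : (𝒰.X i).Opens) (hW : W ≤ (𝒰.f i) ⁻¹ᵁ Ux (𝒰.f i y)),
        a₁ y W hW ≫ 𝒰.f (𝒰.idx (𝒰.f i y)) = W.ι ≫ 𝒰.f i :=
    ⟨fun y W hW => IsOpenImmersion.lift (𝒰.f (𝒰.idx (𝒰.f i y))) (W.ι ≫ 𝒰.f i) (hrange₁ y W hW),
      fun y W hW => IsOpenImmersion.lift_fac _ _ _⟩
  have htop₁ : ∀ (y : 𝒰.X i) (W : (𝒰.X i).Opens) (hW : W ≤ (𝒰.f i) ⁻¹ᵁ Ux (𝒰.f i y)),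
      (⊤ : (W : Scheme.{u}).Opens) ≤ (a₁ y W hW) ⁻¹ᵁ (F (𝒰.idx (𝒰.f i y))).U (p (𝒰.f i y)) := by
    intro y W hW
    refine le_preimage_of_comp_eq_of_mem_image (a₁ y W hW) _ (W.ι ≫ 𝒰.f i) (ha₁ y W hW) _ ⊤ fun z _ => ?_
    rw [← hUx]
    exact hW z.2
  have htopι : ∀ (y : 𝒰.X i) (W : (𝒰.X i).Opens), W ≤ (F i).U y →
      (⊤ : (W : Scheme.{u}).Opens) ≤ W.ι ⁻¹ᵁ (F i).U y :=
    fun y W hW z _ => hW z.2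
  have hwedge₁ : ∀ (y : 𝒰.X i) (W : (𝒰.X i).Opens) (hW : W ≤ (𝒰.f i) ⁻¹ᵁ Ux (𝒰.f i y)),
      W.ι ≫ 𝒰.f i = a₁ y W hW ≫ 𝒰.f (𝒰.idx (𝒰.f i y)) :=
    fun y W hW => (ha₁ y W hW).symm
  have hwedge₂ : ∀ (y y' : 𝒰.X i) (W : (𝒰.X i).Opens) (hW : W ≤ (𝒰.f i) ⁻¹ᵁ Ux (𝒰.f i y))
      (hW' : W ≤ (𝒰.f i) ⁻¹ᵁ Ux (𝒰.f i y')),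
      a₁ y W hW ≫ 𝒰.f (𝒰.idx (𝒰.f i y)) = a₁ y' W hW' ≫ 𝒰.f (𝒰.idx (𝒰.f i y')) :=
    fun y y' W hW hW' => (ha₁ y W hW).trans (ha₁ y' W hW').symm
  have hres₁ : ∀ (y : 𝒰.X i) (W W' : (𝒰.X i).Opens) (hW : W ≤ (𝒰.f i) ⁻¹ᵁ Ux (𝒰.f i y)) (i' : W' ≤ W),
      a₁ y W' (i'.trans hW) = (𝒰.X i).homOfLE i' ≫ a₁ y W hW := by
    intro y W W' hW i'
    rw [← cancel_mono (𝒰.f (𝒰.idx (𝒰.f i y))), Category.assoc, ha₁, ha₁, ← Category.assoc,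
      Scheme.homOfLE_ι]
  refine CechPic.sound ⟨?_⟩
  exact
    { W := fun y => (𝒰.f i) ⁻¹ᵁ Ux (𝒰.f i y) ⊓ (F i).U y
      mem := fun y => ⟨mem (𝒰.f i y), (F i).mem y⟩
      le := fun y => inf_le_left
      le' := fun y => inf_le_right
      lam := fun y W hW => W.topIso.hom
        (transitionDet (pullbackFrame W.ι ((F i).frame y) ≪≫
            (SheafOfModules.overFunctor _ (W.ι ⁻¹ᵁ (F i).U y)).mapIso
              (φ W.ι (a₁ y W (hW.trans inf_le_left)) (hwedge₁ y W (hW.trans inf_le_left))))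
          (pullbackFrame (a₁ y W (hW.trans inf_le_left)) ((F (𝒰.idx (𝒰.f i y))).frame (p (𝒰.f i y))))
          ((F i).enum y) ((F (𝒰.idx (𝒰.f i y))).enum (p (𝒰.f i y)))
          (homOfLE (htopι y W (hW.trans inf_le_right))) (homOfLE (htop₁ y W (hW.trans inf_le_left))))
      inv := fun y W hW => W.topIso.hom
        (transitionDet (pullbackFrame (a₁ y W (hW.trans inf_le_left)) ((F (𝒰.idx (𝒰.f i y))).frame (p (𝒰.f i y))) ≪≫
            (SheafOfModules.overFunctor _ ((a₁ y W (hW.trans inf_le_left)) ⁻¹ᵁ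
              (F (𝒰.idx (𝒰.f i y))).U (p (𝒰.f i y)))).mapIso
              (φ (a₁ y W (hW.trans inf_le_left)) W.ι (hwedge₁ y W (hW.trans inf_le_left)).symm))
          (pullbackFrame W.ι ((F i).frame y)) ((F (𝒰.idx (𝒰.f i y))).enum (p (𝒰.f i y))) ((F i).enum y)
          (homOfLE (htop₁ y W (hW.trans inf_le_left))) (homOfLE (htopι y W (hW.trans inf_le_right))))
      map_lam := fun y W W' hW i' =>
        map_topIso_wedge 𝒰 L φ hnat i' W.ι (a₁ y W (hW.trans inf_le_left)) (hwedge₁ y W (hW.trans inf_le_left))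
          W'.ι (a₁ y W' ((i'.trans hW).trans inf_le_left)) ((𝒰.X i).homOfLE_ι i').symm
          (hres₁ y W W' (hW.trans inf_le_left) i') (hwedge₁ y W' ((i'.trans hW).trans inf_le_left))
          ((F i).frame y) ((F (𝒰.idx (𝒰.f i y))).frame (p (𝒰.f i y))) ((F i).enum y)
          ((F (𝒰.idx (𝒰.f i y))).enum (p (𝒰.f i y))) (htopι y W (hW.trans inf_le_right))
          (htop₁ y W (hW.trans inf_le_left)) (htopι y W' ((i'.trans hW).trans inf_le_right))
          (htop₁ y W' ((i'.trans hW).trans inf_le_left))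
      lam_mul_inv := fun y W hW => by
        dsimp only
        rw [topIso_wedge_mul 𝒰 L φ hcoc W W.ι (a₁ y W (hW.trans inf_le_left)) W.ι
          (hwedge₁ y W (hW.trans inf_le_left)) (hwedge₁ y W (hW.trans inf_le_left)).symm rfl
          ((F i).frame y) ((F (𝒰.idx (𝒰.f i y))).frame (p (𝒰.f i y))) ((F i).frame y) ((F i).enum y)
          ((F (𝒰.idx (𝒰.f i y))).enum (p (𝒰.f i y))) ((F i).enum y) (htopι y W (hW.trans inf_le_right))
          (htop₁ y W (hW.trans inf_le_left)) (htopι y W (hW.trans inf_le_right))]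
        exact topIso_wedge_self 𝒰 L φ hcoc W W.ι rfl ((F i).frame y) ((F i).enum y)
          (htopι y W (hW.trans inf_le_right))
      rel := fun y y' W hy hy' => by
        dsimp only
        -- the three wedge maps on `W`: `W.ι` (chart `i`), `a₁ y W` (chart `i(f_i y)`), `a₁ y' W` (chart `i(f_i y')`)
        have hVW : W ≤ (𝒰.f i) ⁻¹ᵁ (Ux (𝒰.f i y) ⊓ Ux (𝒰.f i y')) :=
          UnitCocycle.le_preimage_inf (𝒰.f i) (hy.trans inf_le_left) (hy'.trans inf_le_left)
        have e₁ : a₁ y W (hy.trans inf_le_left) =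
            (𝒰.f i).resLE _ W hVW ≫ a (𝒰.f i y) (Ux (𝒰.f i y) ⊓ Ux (𝒰.f i y')) inf_le_left := by
          rw [← cancel_mono (𝒰.f (𝒰.idx (𝒰.f i y))), Category.assoc, ha, ha₁, Scheme.Hom.resLE_comp_ι]
        have e₂ : a₁ y' W (hy'.trans inf_le_left) =
            (𝒰.f i).resLE _ W hVW ≫ a (𝒰.f i y') (Ux (𝒰.f i y) ⊓ Ux (𝒰.f i y')) inf_le_right := by
          rw [← cancel_mono (𝒰.f (𝒰.idx (𝒰.f i y'))), Category.assoc, ha, ha₁, Scheme.Hom.resLE_comp_ι]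
        -- the pulled-back transition function of `c` is the wedge value of `(a₁ y W, a₁ y' W)`
        have hc : (UnitCocycle.pullback (𝒰.f i) c).g y y' W (hy.trans inf_le_left) (hy'.trans inf_le_left) =
            W.topIso.hom
              (transitionDet (pullbackFrame (a₁ y W (hy.trans inf_le_left))
                    ((F (𝒰.idx (𝒰.f i y))).frame (p (𝒰.f i y))) ≪≫
                  (SheafOfModules.overFunctor _ ((a₁ y W (hy.trans inf_le_left)) ⁻¹ᵁ
                    (F (𝒰.idx (𝒰.f i y))).U (p (𝒰.f i y)))).mapIso
                    (φ (a₁ y W (hy.trans inf_le_left)) (a₁ y' W (hy'.trans inf_le_left))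
                      (hwedge₂ y y' W (hy.trans inf_le_left) (hy'.trans inf_le_left))))
                (pullbackFrame (a₁ y' W (hy'.trans inf_le_left)) ((F (𝒰.idx (𝒰.f i y'))).frame (p (𝒰.f i y'))))
                ((F (𝒰.idx (𝒰.f i y))).enum (p (𝒰.f i y))) ((F (𝒰.idx (𝒰.f i y'))).enum (p (𝒰.f i y')))
                (homOfLE (htop₁ y W (hy.trans inf_le_left))) (homOfLE (htop₁ y' W (hy'.trans inf_le_left)))) :=
          appLE_topIso_wedge 𝒰 L φ hnat (𝒰.f i) hVW (a (𝒰.f i y) _ inf_le_left) (a (𝒰.f i y') _ inf_le_right)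
            (hwedge _ _ _ _ _) (a₁ y W (hy.trans inf_le_left)) (a₁ y' W (hy'.trans inf_le_left)) e₁ e₂
            (hwedge₂ y y' W (hy.trans inf_le_left) (hy'.trans inf_le_left))
            ((F (𝒰.idx (𝒰.f i y))).frame (p (𝒰.f i y))) ((F (𝒰.idx (𝒰.f i y'))).frame (p (𝒰.f i y')))
            ((F (𝒰.idx (𝒰.f i y))).enum (p (𝒰.f i y))) ((F (𝒰.idx (𝒰.f i y'))).enum (p (𝒰.f i y')))
            (htop _ _ _) (htop _ _ _) (htop₁ y W (hy.trans inf_le_left)) (htop₁ y' W (hy'.trans inf_le_left))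
        -- the transition function of the frame system of `L_i` is the wedge value of `(W.ι, W.ι)`
        have hFi : (F i).cocycle.g y y' W (hy.trans inf_le_right) (hy'.trans inf_le_right) =
            W.topIso.hom
              (transitionDet (pullbackFrame W.ι ((F i).frame y) ≪≫
                  (SheafOfModules.overFunctor _ (W.ι ⁻¹ᵁ (F i).U y)).mapIso (φ W.ι W.ι rfl))
                (pullbackFrame W.ι ((F i).frame y')) ((F i).enum y) ((F i).enum y')
                (homOfLE (htopι y W (hy.trans inf_le_right))) (homOfLE (htopι y' W (hy'.trans inf_le_right)))) :=
          (topIso_wedge_ι 𝒰 L φ hcoc W rfl ((F i).frame y) ((F i).frame y') ((F i).enum y) ((F i).enum y')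
            (hy.trans inf_le_right) (hy'.trans inf_le_right) _ _).symm
        rw [hc, hFi,
          topIso_wedge_mul 𝒰 L φ hcoc W W.ι W.ι (a₁ y' W (hy'.trans inf_le_left)) rfl
            (hwedge₁ y' W (hy'.trans inf_le_left)) (hwedge₁ y' W (hy'.trans inf_le_left))
            ((F i).frame y) ((F i).frame y') ((F (𝒰.idx (𝒰.f i y'))).frame (p (𝒰.f i y'))) ((F i).enum y)
            ((F i).enum y') ((F (𝒰.idx (𝒰.f i y'))).enum (p (𝒰.f i y'))) (htopι y W (hy.trans inf_le_right))
            (htopι y' W (hy'.trans inf_le_right)) (htop₁ y' W (hy'.trans inf_le_left)),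
          topIso_wedge_mul 𝒰 L φ hcoc W W.ι (a₁ y W (hy.trans inf_le_left)) (a₁ y' W (hy'.trans inf_le_left))
            (hwedge₁ y W (hy.trans inf_le_left)) (hwedge₂ y y' W (hy.trans inf_le_left) (hy'.trans inf_le_left))
            (hwedge₁ y' W (hy'.trans inf_le_left)) ((F i).frame y)
            ((F (𝒰.idx (𝒰.f i y))).frame (p (𝒰.f i y))) ((F (𝒰.idx (𝒰.f i y'))).frame (p (𝒰.f i y')))
            ((F i).enum y) ((F (𝒰.idx (𝒰.f i y))).enum (p (𝒰.f i y))) ((F (𝒰.idx (𝒰.f i y'))).enum (p (𝒰.f i y')))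
            (htopι y W (hy.trans inf_le_right)) (htop₁ y W (hy.trans inf_le_left))
            (htop₁ y' W (hy'.trans inf_le_left))] }

end Gluing

end Literature.AlgebraicGeometry.Modules

end
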